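import Summits.QuantumFields.BalabanUV.T4Continuum.Support.NE7PairwiseCouplingStep
import Summits.QuantumFields.BalabanUV.T4Continuum.Support.NE7PairwiseMarginalBox

/-!
# NE7PairwiseCouplingDock — row NE7 (node U5), route «PAIR-CAUCHY»: the marginal lemma (M♭′)
# `NE7PairwiseMarginalBox.marginalBox_tendsto_zero` DOCKED TO THE β-ROAD BY NAME — for a family of IR-pinned runs of
# (0.20) with fading history moduli, an eventual AF lower bound and a printed-type upper bound on the β-functions, a
# NULL n-layer scale-shift modulus of the β-functions gives: at every fixed block scale `m` below the unit lattice the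
# effective couplings of the `K`-run and of ANY finer run agree in the limit `K → ∞`

Cell `pub-balaban`, rung (B)+1 sub-cell t4, lineage `b2b-balaban-t4-ne7-p2` (CRUX PROVER NE7 #2 under the coordinator
ruling «YM redirect», 2026-08-21; generation 49; route text `HOME/t4/b2b-balaban-t4-ne7-p2/g48/ROUTE2-NE7-P2.md` v1.3.1
§2 T.5♭ ∕ (M♭′), §5 step 0).  HONEST FRAMING (page 1): FIXED FINITE T⁴, rung (B)+1 = existence AND uniqueness of the
`ε = L^{−K} → 0` limit of unit-scale averaged expectations, CONDITIONAL on BetaPertH and the nine spine estimates (0/9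
proved); NOT infinite volume, NOT a mass gap, NOT the Clay problem.  NE7 is NOT PRINTED in
[Balaban1984PropagatorsI]–[Balaban1989LargeFieldII] and NOT proved here.  Everything below is [folklore] real analysis over
the tree's vocabulary (`FlowStep`, `T4CouplingMatching` hypothesis SHAPES, never facts); no definition, no cite tag,
nothing printed asserted, no `sorry`.

WHY.  `T4CouplingMatching.injectedRate_of_runs_eventual` is node U2 in the CONSECUTIVE, GEOMETRIC currency: from the
scale-shift RATE `ScaleShiftRate c θ γ β` (`|β_{k+2}(w) − β_{k+1}(tail w)| ≤ cθ^k`, NOT PRINTED) it produces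
`T4CauchySum.InjectedRate`, the source of node U6's summable Cauchy sum.  The route «PAIR-CAUCHY» exits at node U6 ∕ U0
from PAIRWISE matching with remainders that only TEND TO ZERO (`Support/NE7PairwiseCauchy`), so its marginal channel
(leaf T.5♭) asks only for a NULL n-LAYER SCALE-SHIFT MODULUS of the β-functions, uniformly in the number `n` of extra
ultraviolet layers and in their couplings:
  (σ)  `|β (k+n) (w_0,…,w_{k+n}) − β k (w_n,…,w_{k+n})| ≤ σ k` on the boxes, `σ k → 0` —
the β-function produced by the `k`-th fluctuation integral forgets, in the limit of large depth `k`, both how many layers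
lie above the `k + 1` most recent ones and their couplings (for the one-loop part this is plain CONVERGENCE
`β⁰_k → β⁰_∞`, i.e. G-an2-4's (CONV-C) as convergence without rate; for the remainder it is the null-currency form of the
cell's wall (γ2)∕(γ3); [Balaban1987RG1] p. 264 defers every such property to «a separate paper» — NOT PRINTED, a
hypothesis here).  THIS FILE PROVES THE DOCKING: for a family of runs `K ↦ g K` (`K` steps, `RGEqH K β (g K)`), all
couplings in `]0, γ]`, all pinned at the same renormalised coupling (`g K K = gIR`), an arbitrary offset sequence
`K ↦ n K` (the finer partner of run `K` is run `K + n K`; arbitrary sequences = uniformity in the finer run), history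
moduli `HistLipschitz Λ γ β` with `FadingMemory C θ Λ`, the eventual AF lower bound `EventualLowerH b γ k₀ β`, the
printed-type upper bound `BetaUpperH β′ γ β`, (σ), and the AF-window `C·((k₀+1)γ³ + 2γ∕b)∕(1−θ) ≤ q < 1` (the SAME
IR-coupling smallness as `T4CouplingMatching` §4 ∕ `injectedRate_of_runs_eventual`, CM-3 class):
  `∀ m, |1∕(g K (K−m))² − 1∕(g (K + n K) (K − m + n K))²| → 0` as `K → ∞`
(`K − m + n K = (K + n K) − m`: block scale `m` counted from the unit lattice in both runs).  Mechanism: §1 of the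
companion `NE7PairwiseCouplingStep` (offset recursion + backward accumulation) re-indexed to `m = K − j` IS hypothesis
(H′) of `NE7PairwiseMarginalBox` with `d K m` = the discrepancy, `f K j` = the coupling gap at block scale `j` (box `≤ γ`,
conversion `≤ u·d` by `T4CouplingMatching.abs_sub_le_of_inv_sq`), `u K j = (g^A)²g^B` with `Σ_j u K j ≤ (k₀+1)γ³ + 2γ∕b`
(`sum_weightsOff_le_of_eventualLower`), sources `s K m = Σ_{t<m} σ(K − t − 1)` (null at each fixed `m`: finitely many
shifted copies of a null sequence), a-priori bound `1∕gIR² + β′·m` (`discOff_le_affine`).  So leaf T.5♭ of the route is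
node U2's machinery VERBATIM with `ScaleShiftRate` replaced by (σ) — the qualitative twin of `injectedRate_of_runs_eventual`.

WHAT IS PROVED ([folklore]).
§1 re-indexing: `sum_reflect_inner` (`Σ_{i≤l} θ^{l−i} F i = Σ_{a≤l} θ^a F (l−a)`), `sum_Ico_reflect_eq`
   (`Σ_{l∈[K−m,K)} G l = Σ_{t<m} G (K−(t+1))` for `m ≤ K`), `sum_Ico_reflect_le` (`≤ Σ_{m′≤m} G (K−m′)` for `G ≥ 0`),
   `feedback_reindex` (the double sum of (H′) from the accumulated history shifts).
§2 `shiftSources_tendsto_zero` (the accumulated scale-shift sources are null at each fixed block scale),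
   **`couplingGap_tendsto_zero`** (the statement displayed above).

NOT DELIVERED: (σ) itself (THE marginal ask of the route — rows an1–an4 ∕ G-an2-4 for β⁰ as convergence, the remainder's
two-depth modulus = the wall (γ2)∕(γ3) in null currency), `FadingMemory` ∕ `EventualLowerH` ∕ `BetaUpperH` for
[Balaban1987RG1]'s (1.22) (NOT PRINTED; BetaPertH territory), the pins (Theorem 2's `g_K = g`, node H3).  NOT NE7 (spine 0/9
unchanged), NOT summit progress.  HONEST DEPENDENCY: continuum YM on T⁴ ⇐ BetaPertH ∧ nine spine estimates (0/9 proved);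
BetaPertH ⇐ (D1) ∧ (D4) ∧ CAP+tail; G-an2-4 gates asym, D1 and NE2/3/4.
-/

noncomputable section

open Finset Filter Topology
open scoped BigOperators

namespace Summit.QuantumFields.BalabanUV.T4Continuum.NE7PairwiseCouplingDock

open Literature.MathematicalPhysics.QuantumFieldTheory.Balaban1983to89
open Literature.MathematicalPhysics.QuantumFieldTheory.Balaban1983to89.FlowStep
open Literature.MathematicalPhysics.QuantumFieldTheory.Balaban1983to89.T4CouplingMatching
open Summit.QuantumFields.BalabanUV.T4Continuum.NE7PairwiseCouplingStep

/-! ## §1 Re-indexing to block scales counted from the unit lattice (`m = K − j`) -/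

/-- Inner reflection: `Σ_{i ≤ l} θ^{l−i} F i = Σ_{a ≤ l} θ^a F (l − a)` (the age `a = l − i` of the coupling `g_i` seen from
scale `l`). [folklore] -/
theorem sum_reflect_inner (θ : ℝ) (F : ℕ → ℝ) (l : ℕ) :
    ∑ i ∈ range (l + 1), θ ^ (l - i) * F i = ∑ a ∈ range (l + 1), θ ^ a * F (l - a) := by
  calc ∑ i ∈ range (l + 1), θ ^ (l - i) * F i
      = ∑ a ∈ range (l + 1), θ ^ (l - (l + 1 - 1 - a)) * F (l + 1 - 1 - a) :=
        (Finset.sum_range_reflect (fun i => θ ^ (l - i) * F i) (l + 1)).symm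
    _ = ∑ a ∈ range (l + 1), θ ^ a * F (l - a) := by
        refine Finset.sum_congr rfl fun a ha => ?_
        have ha' := mem_range.mp ha
        rw [show l + 1 - 1 - a = l - a by omega, show l - (l - a) = a by omega]

/-- Outer reflection: for `m ≤ K`, `Σ_{l ∈ [K−m, K)} G l = Σ_{t < m} G (K − (t+1))` (block scale `t + 1 = K − l` counted
from the unit lattice). [folklore] -/
theorem sum_Ico_reflect_eq (G : ℕ → ℝ) {K m : ℕ} (hm : m ≤ K) :
    ∑ l ∈ Ico (K - m) K, G l = ∑ t ∈ range m, G (K - (t + 1)) := by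
  rw [Finset.sum_Ico_eq_sum_range, show K - (K - m) = m by omega]
  calc ∑ t ∈ range m, G (K - m + t)
      = ∑ t ∈ range m, G (K - m + (m - 1 - t)) := (Finset.sum_range_reflect (fun t => G (K - m + t)) m).symm
    _ = ∑ t ∈ range m, G (K - (t + 1)) :=
        Finset.sum_congr rfl fun t ht => by
          have := mem_range.mp ht
          rw [show K - m + (m - 1 - t) = K - (t + 1) by omega]

/-- Outer reflection with the harmless extra term `m′ = 0`: for `m ≤ K` and `G ≥ 0`,
`Σ_{l ∈ [K−m, K)} G l ≤ Σ_{m′ ≤ m} G (K − m′)`. [folklore] -/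
theorem sum_Ico_reflect_le {G : ℕ → ℝ} (hG : ∀ l, 0 ≤ G l) {K m : ℕ} (hm : m ≤ K) :
    ∑ l ∈ Ico (K - m) K, G l ≤ ∑ m' ∈ range (m + 1), G (K - m') := by
  rw [sum_Ico_reflect_eq G hm, Finset.sum_range_succ', Nat.sub_zero]
  linarith [hG K]

/-- **THE FEEDBACK RE-INDEXED.**  With fading weights (`θ ≥ 0`) and a nonnegative coupling gap `F`, for `m ≤ K`:
`Σ_{l∈[K−m,K)} Σ_{i≤l} θ^{l−i} F i ≤ Σ_{m′≤m} Σ_{a ≤ K−m′} θ^a F (K − (m′+a))` — the double sum of hypothesis (H′) of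
`NE7PairwiseMarginalBox` with `f K j = F (K − j)` (coupling gap at block scale `j`). [folklore] -/
theorem feedback_reindex {θ : ℝ} (hθ : 0 ≤ θ) {F : ℕ → ℝ} (hF : ∀ i, 0 ≤ F i) {K m : ℕ} (hm : m ≤ K) :
    ∑ l ∈ Ico (K - m) K, ∑ i ∈ range (l + 1), θ ^ (l - i) * F i
      ≤ ∑ m' ∈ range (m + 1), ∑ a ∈ range (K - m' + 1), θ ^ a * F (K - (m' + a)) := by
  have hG : ∀ l, 0 ≤ ∑ i ∈ range (l + 1), θ ^ (l - i) * F i := fun l =>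
    sum_nonneg fun i _ => mul_nonneg (pow_nonneg hθ _) (hF i)
  refine (sum_Ico_reflect_le hG hm).trans (le_of_eq ?_)
  refine Finset.sum_congr rfl fun m' _ => ?_
  rw [sum_reflect_inner θ F (K - m')]
  refine Finset.sum_congr rfl fun a _ => ?_
  rw [Nat.sub_sub]

/-! ## §2 The docking: (M♭′) consumed with the tree's objects -/

/-- The accumulated n-layer scale-shift sources at block scale `m`, `Σ_{t<m} σ (K − (t+1))`, tend to zero as `K → ∞`
at each fixed `m` when `σ → 0` (finitely many shifted copies of one null sequence). [folklore] -/
theorem shiftSources_tendsto_zero {σ : ℕ → ℝ} (hσ0 : Tendsto σ atTop (𝓝 0)) (m : ℕ) :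
    Tendsto (fun K => ∑ t ∈ range m, σ (K - (t + 1))) atTop (𝓝 0) := by
  have h : ∀ t ∈ range m, Tendsto (fun K => σ (K - (t + 1))) atTop (𝓝 0) := fun t _ =>
    hσ0.comp (tendsto_sub_atTop_nat (t + 1))
  simpa using tendsto_finsetSum (range m) h

/-- **LEAF T.5♭ OF THE ROUTE «PAIR-CAUCHY», DOCKED TO THE β-ROAD BY NAME** (the qualitative twin of
`T4CouplingMatching.injectedRate_of_runs_eventual`).  A family of runs `K ↦ g K` of (0.20) with the same
history-dependent family `β` (`RGEqH K β (g K)`), all couplings in `]0, γ]`, all pinned at the renormalised coupling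
(`g K K = gIR` — Theorem 2's `g_K = g`, node H3, a hypothesis); an arbitrary offset sequence `n` (run `K` is compared with
the finer run `K + n K`); history moduli `HistLipschitz Λ γ β` with `FadingMemory C θ Λ` (`0 ≤ θ < 1`); the eventual AF
lower bound `EventualLowerH b γ k₀ β` (`b > 0`) and the printed-type upper bound `BetaUpperH β′ γ β` (`β′ ≥ 0`); the NULL
n-LAYER SCALE-SHIFT MODULUS (σ): for all `n, k` and every coupling sequence `w` with `w_i ∈ ]0, γ]` for `i ≤ k + n`,
`|β (k+n) (prefixOf w (k+n)) − β k (prefixOf (fun i => w (i+n)) k)| ≤ σ k`, with `σ → 0`; and the AF-window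
`C·((k₀+1)γ³ + 2γ∕b)∕(1−θ) ≤ q < 1`.  THEN for every block scale `m`:
`|1∕(g K (K−m))² − 1∕(g (K + n K) (K − m + n K))²| → 0` as `K → ∞`.
Every hypothesis about `β` is an UNPRINTED input (cell NE4 ∕ (γ2)–(γ3) ∕ BetaPertH territory; [Balaban1987RG1] p. 264);
the theorem is bookkeeping: `NE7PairwiseCouplingStep` §§1–3 re-indexed (§1) into hypothesis (H′) of
`NE7PairwiseMarginalBox.marginalBox_tendsto_zero`. [folklore] -/
theorem couplingGap_tendsto_zero {β : HBeta} {γ b β' C θ q gIR : ℝ} {k₀ : ℕ} {Λ : ℕ → ℕ → ℝ}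
    {σ : ℕ → ℝ} (g : ℕ → ℕ → ℝ) (n : ℕ → ℕ)
    (hγ : 0 < γ) (hb : 0 < b) (hθ0 : 0 ≤ θ) (hθ1 : θ < 1) (hC : 0 ≤ C) (hβ' : 0 ≤ β')
    (hrun : ∀ N, RGEqH N β (g N)) (hbox : ∀ N i, i ≤ N → 0 < g N i ∧ g N i ≤ γ)
    (hpin : ∀ N, g N N = gIR)
    (hL : HistLipschitz Λ γ β) (hΛ : FadingMemory C θ Λ)
    (hlo : EventualLowerH b γ k₀ β) (hup : BetaUpperH β' γ β)
    (hσ : ∀ n k (w : ℕ → ℝ), (∀ i, i ≤ k + n → 0 < w i ∧ w i ≤ γ) →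
      |β (k + n) (prefixOf w (k + n)) - β k (prefixOf (fun i => w (i + n)) k)| ≤ σ k)
    (hσ0 : Tendsto σ atTop (𝓝 0))
    (hq : C * ((((k₀ : ℝ) + 1) * γ ^ 3 + 2 * γ / b) / (1 - θ)) ≤ q) (hq1 : q < 1) :
    ∀ m, Tendsto (fun K => |1 / (g K (K - m)) ^ 2 - 1 / (g (K + n K) (K - m + n K)) ^ 2|)
      atTop (𝓝 0) := by
  -- positivity of the pinned coupling and of the window constants
  have hgIR : 0 < gIR := by rw [← hpin 0]; exact (hbox 0 0 le_rfl).1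
  have hU0 : 0 ≤ ((k₀ : ℝ) + 1) * γ ^ 3 + 2 * γ / b := by positivity
  have h1θ : 0 < 1 - θ := by linarith
  have hq0 : 0 ≤ q := le_trans (by positivity) hq
  -- index facts used throughout: the finer partner's scale `K - j + n K ≤ K + n K`
  have hidx : ∀ K j, K - j + n K ≤ K + n K := fun K j => by omega
  refine NE7PairwiseMarginalBox.marginalBox_tendsto_zero
    (θ := θ) (C := C) (U := ((k₀ : ℝ) + 1) * γ ^ 3 + 2 * γ / b) (q := q) (γbar := γ)
    (B₀ := 1 / gIR ^ 2) (B₁ := β')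
    (u := fun K j => (g K (K - j)) ^ 2 * g (K + n K) (K - j + n K))
    (f := fun K j => |g K (K - j) - g (K + n K) (K - j + n K)|)
    (s := fun K m => ∑ t ∈ range m, σ (K - (t + 1)))
    (d := fun K m => |1 / (g K (K - m)) ^ 2 - 1 / (g (K + n K) (K - m + n K)) ^ 2|)
    hθ0 hθ1 hC hγ.le ?_ ?_ hq hq0 hq1 ?_ ?_ (shiftSources_tendsto_zero hσ0) ?_ (by positivity) hβ' ?_ ?_
  · -- hu0 : the conversion weights are nonnegative
    intro K j
    exact mul_nonneg (sq_nonneg _) (hbox (K + n K) _ (hidx K j)).1.le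
  · -- hU : the AF weight sum, reflected to block scales
    intro K
    have hw := sum_weightsOff_le_of_eventualLower (n := n K) hγ hb (hrun K) (hrun (K + n K)) (hbox K)
      (hbox (K + n K)) hlo
    calc ∑ j ∈ range (K + 1), (g K (K - j)) ^ 2 * g (K + n K) (K - j + n K)
        = ∑ j ∈ range (K + 1), (g K (K + 1 - 1 - j)) ^ 2 * g (K + n K) (K + 1 - 1 - j + n K) := by
          refine Finset.sum_congr rfl fun j _ => ?_
          rw [show K + 1 - 1 - j = K - j by omega]
      _ = ∑ i ∈ range (K + 1), (g K i) ^ 2 * g (K + n K) (i + n K) :=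
          Finset.sum_range_reflect (fun i => (g K i) ^ 2 * g (K + n K) (i + n K)) (K + 1)
      _ ≤ ((k₀ : ℝ) + 1) * γ ^ 3 + 2 * γ / b := hw
  · -- hfγ : the coupling gap lies in the printed box
    intro K j
    exact abs_sub_le_of_box (hbox K (K - j) (Nat.sub_le K j)) (hbox (K + n K) _ (hidx K j))
  · -- hfu : the x → g conversion
    intro K j
    exact abs_sub_le_of_inv_sq (hbox K (K - j) (Nat.sub_le K j)).1 (hbox (K + n K) _ (hidx K j)).1
  · -- hd0
    intro K m
    exact abs_nonneg _
  · -- hB : the scale-wise affine a-priori bound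
    intro K m hm
    have h := discOff_le_affine (n := n K) (hrun K) (hrun (K + n K)) (hbox K) (hbox (K + n K))
      ((hpin K).trans (hpin (K + n K)).symm) hup hβ' (j := K - m) (Nat.sub_le K m)
    rw [hpin K, show K - (K - m) = m by omega] at h
    exact h
  · -- H : hypothesis (H′) from the accumulated offset recursion
    intro K m hm
    have hpinK : g K K = g (K + n K) (K + n K) := (hpin K).trans (hpin (K + n K)).symm
    have hback := discOff_backward (n := n K) (hrun K) (hrun (K + n K)) (hbox K) (hbox (K + n K)) hpinK hL
      (j := K - m) (Nat.sub_le K m)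
    rw [Finset.sum_add_distrib] at hback
    -- the scale-shift sources
    have hS : ∑ l ∈ Ico (K - m) K,
        |β (l + n K) (prefixOf (g (K + n K)) (l + n K)) - β l (prefixOf (fun i => g (K + n K) (i + n K)) l)|
        ≤ ∑ t ∈ range m, σ (K - (t + 1)) := by
      rw [← sum_Ico_reflect_eq σ hm]
      refine Finset.sum_le_sum fun l hl => ?_
      have hl' := (Finset.mem_Ico.mp hl).2
      exact hσ (n K) l (g (K + n K)) fun i hi => hbox (K + n K) i (by omega)
    -- the history shifts through the fading memory, re-indexed
    have hF0 : ∀ i, 0 ≤ |g K i - g (K + n K) (i + n K)| := fun i => abs_nonneg _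
    have hH : ∑ l ∈ Ico (K - m) K, ∑ i ∈ range (l + 1), Λ l i * |g K i - g (K + n K) (i + n K)|
        ≤ C * ∑ m' ∈ range (m + 1), ∑ a ∈ range (K - m' + 1),
            θ ^ a * |g K (K - (m' + a)) - g (K + n K) (K - (m' + a) + n K)| := by
      calc ∑ l ∈ Ico (K - m) K, ∑ i ∈ range (l + 1), Λ l i * |g K i - g (K + n K) (i + n K)|
          ≤ ∑ l ∈ Ico (K - m) K, ∑ i ∈ range (l + 1), C * (θ ^ (l - i) * |g K i - g (K + n K) (i + n K)|) := by
            refine Finset.sum_le_sum fun l _ => Finset.sum_le_sum fun i hi => ?_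
            have hil : i ≤ l := Nat.lt_succ_iff.mp (mem_range.mp hi)
            calc Λ l i * |g K i - g (K + n K) (i + n K)|
                ≤ C * θ ^ (l - i) * |g K i - g (K + n K) (i + n K)| :=
                  mul_le_mul_of_nonneg_right (hΛ l i hil).2 (hF0 i)
              _ = C * (θ ^ (l - i) * |g K i - g (K + n K) (i + n K)|) := by ring
        _ = C * ∑ l ∈ Ico (K - m) K, ∑ i ∈ range (l + 1), θ ^ (l - i) * |g K i - g (K + n K) (i + n K)| := by
            rw [Finset.mul_sum]
            refine Finset.sum_congr rfl fun l _ => ?_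
            rw [Finset.mul_sum]
        _ ≤ C * ∑ m' ∈ range (m + 1), ∑ a ∈ range (K - m' + 1),
              θ ^ a * |g K (K - (m' + a)) - g (K + n K) (K - (m' + a) + n K)| :=
            mul_le_mul_of_nonneg_left
              (feedback_reindex hθ0 (F := fun i => |g K i - g (K + n K) (i + n K)|) hF0 hm) hC
    linarith [hback, hS, hH]

end Summit.QuantumFields.BalabanUV.T4Continuum.NE7PairwiseCouplingDock

end
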